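import Summits.HodgeConjecture.HodgeConjecture.Theorems.VHCAbelianSchemesRoadSecantQuotientResidualLefschetzFibre
import Literature.AlgebraicGeometry.HodgeTheory.WeilTypeProducts
import Literature.AlgebraicGeometry.HodgeTheory.WeilClassesRationalPlane
import HarnessLib

/-!
# Road b02 (`VHCAbelianSchemesRoad`, D-0059) — stub 2b″ of crux `SemiregularSheafRepresentativesTwAtDiag` (stmt-HodgeConjecture-19787):
# THE WEIL PLANE AT A LEFSCHETZ FIBRE IS A PLANE OF LEFSCHETZ CLASSES; the QM-powers `S^{N+1}` are abelian varieties OF WEIL TYPE (for every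
# quadratic `K` inside the quaternion algebra) all of whose Weil classes are polynomials in divisor classes — UNCONDITIONAL

research route conditional on HC_CM; not a corollary; Q11.4-sentence-2 already refuted in dim ≥ 3.

FACT-FREE; `HC_CM` nowhere; no `def`; sequel to `VHCAbelianSchemesRoadSecantQuotientResidualLefschetzFibre` (p535302: Lefschetz fibres `B = D` as
served fibres of the pinned `(6,3)` residual, supplied by powers of abelian varieties of dimension `≤ 3`; headline the QM-cubes `S_δ³` of the
NON-SPLIT Weil components — there described in the module docstring as arithmetic AS PRINTED). This file puts the Weil-type half of that
description in the kernel, on the tree's carriers `IsWeilType` (van Geemen 4.9) and `weilClassesOf` (the complexified Weil plane `W_K ⊗ ℂ = E₊ ⊔ E₋`):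

* §1 **`weilClassesOf_le_divisorClassesSpan_of_isWeilType_of_isDivisorGenerated`**: for EVERY abelian variety of Weil type `(A, φ, n, d)` whose
  Hodge ring is generated by divisor classes, the Weil plane lies in `Dⁿ(A) ⊗ ℂ` — hence in the algebraic classes
  (`…_le_algebraicClasses_…`): the plane is the `ℂ`-span of its rational classes (`weilClassesOf_eq_span_isRationalClass`), each of which is of
  Hodge type `(n,n)` (van Geemen 4.10, `IsWeilType.isOfHodgeType_of_mem_weilClassesOf`), hence Lefschetz by `B = D`. (At a GENERAL member of a
  Weil component `W_K ⊄ D` — no contradiction: `B = D` fails there; the statement is about the special members.)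
* §2 **QM-POWERS ARE OF WEIL TYPE**: an abelian surface `S` with endomorphisms `φ`, `ψ`, `φ² = −d`, `ψ² = +e` (`d, e ≥ 1`), `φψ = −ψφ` — i.e.
  `(−d, e)_ℚ ↪ End⁰(S)` with integral standard generators, an INDEFINITE quaternion algebra (Albert type II when it is a division algebra: the
  false elliptic curves) — is of Weil type `(1, d)` for `K = ℚ(φ)` (van Geemen–Verra 2003 Lemma 4.5, the tree's
  `isWeilType_of_anticomm_of_sq_eq_nsmul`), so EVERY POWER `(S^{N+1}, φ^{N+1})` is of Weil type `(N+1, d)` (Moonen–Zarhin (1.9), the tree's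
  `IsWeilType.powSucc`): `isWeilType_powSucc_of_anticomm_of_sq_eq_nsmul`; the definite variant (`ψ² = −e`) alongside.
* §3 **… AND THEIR WEIL PLANES ARE LEFSCHETZ, HENCE ALGEBRAIC — UNCONDITIONALLY**: every abelian surface is stably non-degenerate (tree:
  Moonen–Zarhin (2.2) + `E′ × E″`), so §1 applies to every Weil structure on every `S^{N+1}` (`weilClassesOf_powSucc_surface_le_divisorClassesSpan`,
  `…_le_algebraicClasses`), in particular to the QM-cubes `(S³, ℚ(φ))` of the prequel (`weilClassesOf_qmPower_le_divisorClassesSpan` /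
  `…_le_algebraicClasses`: `N = 2`, `K = ℚ(√−D) ⊂ B_δ = (−D, −δ)_ℚ`), and to everything `K`-ISOGENOUS to such a power
  (`weilClassesOf_le_divisorClassesSpan_of_isIsogeny_powSucc_surface`, Weil type and `B = D` being `K`-isogeny invariants). So on the QM-cube curve of a
  non-split `(3, d, δ)` component the (limit of the) Weil class IS a Lefschetz class, in the kernel — the honest content of «second honest special
  fibre» for the Weil residual; the carrier problem there (prequel §3, `anchoredCarrierAt_lefschetz_iff_divisorial`) asks for an `AdmTw`-object whose
  `κ₃` is that Lefschetz class modulo `θ³`.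

What is NOT claimed: (b″), (a″), the rung, the crux, any carrier statement, any cell, VHC, `HC_AV`, HC; algebraicity of Weil classes at any
NON-special member; that a given Weil component contains a given QM-power (family supply / Landherr: untyped, prequel docstring).
References: [cite: vanGeemenVerra2003QuaternionicPryms, Lemma 4.5 and its proof] [cite: vanGeemen1994HodgeAV, 4.9, 4.10, 4.14, Lemma 5.2, 5.4]
[cite: MoonenZarhin1999LowDim, (1.9), §2 (2.2), condition (D)] [cite: Gordon1999HodgeAVSurvey, Thm. 7.5 and Def. 7.6]
[cite: Deligne1982HodgeCycles, §4 (4.3)–Prop. 4.4] [cite: Markman2025SecantWeil, §1.1 and Thm. 1.5.1] [cite: Bloch1972Semiregularity, Remark (7.5)].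
-/

noncomputable section

open CategoryTheory CategoryTheory.Limits AlgebraicGeometry Topology

-- the cell's namespace repeats the summit name (`Summit.HodgeConjecture.HodgeConjecture…`), as in every `Ring2*` file
set_option linter.dupNamespace false
namespace Summit.HodgeConjecture.HodgeConjecture.Ring2.SemiregularRepresentatives

open Literature.AlgebraicGeometry Literature.AlgebraicGeometry.Motives
open Literature.AlgebraicGeometry.HodgeTheory
open Literature.AlgebraicTopology.SingularHomology
open Literature.Barriers.HodgeConjecture (divisorClassesSpan)

variable {A X S : AbelianVariety ℂ} {φ ψ : A ⟶ A} {n d e N : ℕ}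

/-! ## §1 The Weil plane of a divisor-generated abelian variety of Weil type is a plane of Lefschetz classes -/

/-- **THE WEIL PLANE AT A LEFSCHETZ FIBRE IS LEFSCHETZ**: if `(A, φ)` is of Weil type `(n, d)` and `B•(A) = D•(A) ⊗ ℂ`
(`IsDivisorGenerated A`), then `W_K ⊗ ℂ = weilClassesOf A φ n d ⊆ Dⁿ(A) ⊗ ℂ`: the plane is spanned by its rational classes, each of Hodge type
`(n,n)`. [cite: vanGeemen1994HodgeAV, 4.9–4.10 and §2.4] [cite: MoonenZarhin1999LowDim, (1.9) and §2 condition (D)] -/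
theorem weilClassesOf_le_divisorClassesSpan_of_isWeilType_of_isDivisorGenerated (hW : IsWeilType A φ n d) (hD : IsDivisorGenerated A) :
    weilClassesOf A φ n d ≤ divisorClassesSpan A.X A.dim n := by
  rw [weilClassesOf_eq_span_isRationalClass hW.pos hW.dim_eq hW.d_pos hW.sq_eq]
  refine Submodule.span_le.2 ?_
  rintro c ⟨hcQ, hc⟩
  have hpp : IsOfHodgeType A.dim A.X (2 * n) n n c := by
    rw [hW.dim_eq]
    exact hW.isOfHodgeType_of_mem_weilClassesOf hc
  exact hD n c hcQ hpp

/-- **… HENCE ALGEBRAIC**: `weilClassesOf A φ n d ⊆ Nⁿ H²ⁿ(A(ℂ); ℂ)` for every divisor-generated abelian variety of Weil type (Lefschetz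
`(1,1)` and products on `A.X`). [cite: vanGeemen1994HodgeAV, §2.4 and 4.10] [cite: VoisinHodgeI2002, Thm. 11.30] -/
theorem weilClassesOf_le_algebraicClasses_of_isWeilType_of_isDivisorGenerated (hW : IsWeilType A φ n d) (hD : IsDivisorGenerated A) :
    weilClassesOf A φ n d ≤ algebraicClasses A.X n :=
  (weilClassesOf_le_divisorClassesSpan_of_isWeilType_of_isDivisorGenerated hW hD).trans
    (divisorClassesSpan_le_algebraicClasses_of_isSmoothProjective (AbelianVariety.isSmoothProjective_holds (A := A)) n)

/-- The same for a STABLY NON-DEGENERATE `A` (Gordon 7.5 ∕ 7.6), the form in which the tree supplies `B = D`.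
[cite: Gordon1999HodgeAVSurvey, Thm. 7.5 and Def. 7.6] [cite: vanGeemen1994HodgeAV, 4.10] -/
theorem weilClassesOf_le_divisorClassesSpan_of_isWeilType_of_isStablyNondegenerate (hW : IsWeilType A φ n d)
    (hA : IsStablyNondegenerate A) : weilClassesOf A φ n d ≤ divisorClassesSpan A.X A.dim n :=
  weilClassesOf_le_divisorClassesSpan_of_isWeilType_of_isDivisorGenerated hW hA.isDivisorGenerated

/-! ## §2 QM-powers are of Weil type for every quadratic field inside the quaternion algebra -/

/-- **A QM SURFACE IS OF WEIL TYPE `(1, d)` FOR `K = ℚ(φ)`**: `dim S = 2`, `φ² = −d`, `ψ² = +e` (`d, e ≥ 1`), `φψ = −ψφ` (an indefinite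
quaternion algebra `(−d, e)_ℚ ↪ End⁰(S)`; van Geemen–Verra Lemma 4.5 with `j` invertible — the tree's `isWeilType_of_anticomm_of_sq_eq_nsmul`
at `n = 1`). [cite: vanGeemenVerra2003QuaternionicPryms, Lemma 4.5 and its proof] [cite: MoonenZarhin1999LowDim, §2 (2.2) type II(1)] -/
theorem isWeilType_surface_of_anticomm_of_sq_eq_nsmul {φ ψ : S ⟶ S} (hd : 0 < d) (he : 0 < e) (hS : S.dim = 2)
    (hφ : φ ≫ φ = -(d • 𝟙 S)) (hψ : ψ ≫ ψ = e • 𝟙 S) (h : φ ≫ ψ = -(ψ ≫ φ)) : IsWeilType S φ 1 d :=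
  isWeilType_of_anticomm_of_sq_eq_nsmul Nat.one_pos hd he (by rw [hS]) hφ hψ h

/-- **EVERY POWER OF A QM SURFACE IS OF WEIL TYPE: `(S^{N+1}, φ^{N+1})` is of Weil type `(N+1, d)`** (the QM-cubes: `N = 2`, sixfolds of Weil
type `(3, d)` for `K = ℚ(φ) ⊂ (−d, e)_ℚ`; multiplicities add, Moonen–Zarhin (1.9), the tree's `IsWeilType.powSucc`).
[cite: MoonenZarhin1999LowDim, (1.9)] [cite: vanGeemenVerra2003QuaternionicPryms, Lemma 4.5] [cite: vanGeemen1994HodgeAV, 4.9 and 5.4] -/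
theorem isWeilType_powSucc_of_anticomm_of_sq_eq_nsmul {φ ψ : S ⟶ S} (hd : 0 < d) (he : 0 < e) (hS : S.dim = 2)
    (hφ : φ ≫ φ = -(d • 𝟙 S)) (hψ : ψ ≫ ψ = e • 𝟙 S) (h : φ ≫ ψ = -(ψ ≫ φ)) (N : ℕ) :
    IsWeilType (S.powSucc N) (powSuccMap φ N) (N + 1) d := by
  simpa using (isWeilType_surface_of_anticomm_of_sq_eq_nsmul hd he hS hφ hψ h).powSucc N

/-- The DEFINITE variant (`ψ² = −e`: `(−d, −e)_ℚ ↪ End⁰(S)`, Lemma 4.5 as printed): `(S^{N+1}, φ^{N+1})` is of Weil type `(N+1, d)`.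
[cite: vanGeemenVerra2003QuaternionicPryms, Lemma 4.5] [cite: MoonenZarhin1999LowDim, (1.9)] -/
theorem isWeilType_powSucc_of_anticomm {φ ψ : S ⟶ S} (hd : 0 < d) (he : 0 < e) (hS : S.dim = 2)
    (hφ : φ ≫ φ = -(d • 𝟙 S)) (hψ : ψ ≫ ψ = -(e • 𝟙 S)) (h : φ ≫ ψ = -(ψ ≫ φ)) (N : ℕ) :
    IsWeilType (S.powSucc N) (powSuccMap φ N) (N + 1) d := by
  simpa using (isWeilType_of_anticomm Nat.one_pos hd he (by rw [hS]) hφ hψ h).powSucc N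

/-! ## §3 Weil planes on powers of abelian surfaces (and on everything `K`-isogenous to them) are Lefschetz, hence algebraic -/

/-- **EVERY WEIL STRUCTURE ON A POWER OF AN ABELIAN SURFACE HAS A LEFSCHETZ WEIL PLANE**: `dim S = 2`, `(S^{N+1}, Φ)` of Weil type `(m, d)` for
ANY `Φ` ⟹ `weilClassesOf (S^{N+1}) Φ m d ⊆ Dᵐ ⊗ ℂ` (every abelian surface is stably non-degenerate — the tree's Moonen–Zarhin (2.2) for the four
simple types and `E′ × E″` — so `B = D` on `S^{N+1}`). UNCONDITIONAL. [cite: MoonenZarhin1999LowDim, §2 (2.2) and condition (D)]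
[cite: vanGeemen1994HodgeAV, 4.10 and Thm. 4.3] -/
theorem weilClassesOf_powSucc_surface_le_divisorClassesSpan (hS : S.dim = 2) {Φ : S.powSucc N ⟶ S.powSucc N} {m : ℕ}
    (hW : IsWeilType (S.powSucc N) Φ m d) :
    weilClassesOf (S.powSucc N) Φ m d ≤ divisorClassesSpan (S.powSucc N).X (S.powSucc N).dim m :=
  weilClassesOf_le_divisorClassesSpan_of_isWeilType_of_isDivisorGenerated hW
    ((isStablyNondegenerate_of_dim_pos_of_dim_le_three (X := S) (by omega) (by omega)).isDivisorGenerated_powSucc N)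

/-- **… hence ALGEBRAIC**: the Weil classes of every Weil structure on every power of an abelian surface are algebraic — unconditionally.
[cite: MoonenZarhin1999LowDim, §2 (2.2)] [cite: vanGeemen1994HodgeAV, §2.4 and 4.10] -/
theorem weilClassesOf_powSucc_surface_le_algebraicClasses (hS : S.dim = 2) {Φ : S.powSucc N ⟶ S.powSucc N} {m : ℕ}
    (hW : IsWeilType (S.powSucc N) Φ m d) : weilClassesOf (S.powSucc N) Φ m d ≤ algebraicClasses (S.powSucc N).X m :=
  weilClassesOf_le_algebraicClasses_of_isWeilType_of_isDivisorGenerated hW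
    ((isStablyNondegenerate_of_dim_pos_of_dim_le_three (X := S) (by omega) (by omega)).isDivisorGenerated_powSucc N)

/-- **THE QM-POWERS `(S^{N+1}, ℚ(φ))`: WEIL TYPE `(N+1, d)` WITH A LEFSCHETZ WEIL PLANE** — `S` a surface with `(−d, e)_ℚ ↪ End⁰(S)` (`φ² = −d`,
`ψ² = +e`, `φψ = −ψφ`); at `N = 2` these are the QM-cubes `S_δ³` of the prequel (`K = ℚ(√−D)`, `B_δ = (−D, −δ)_ℚ`, `−δ > 0`): the Weil plane of
the sixfold `(S³, K)` consists of polynomials in divisor classes. [cite: vanGeemenVerra2003QuaternionicPryms, Lemma 4.5]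
[cite: MoonenZarhin1999LowDim, (1.9) and §2 (2.2)] [cite: vanGeemen1994HodgeAV, 4.9, 4.10 and 5.4] -/
theorem weilClassesOf_qmPower_le_divisorClassesSpan {φ ψ : S ⟶ S} (hd : 0 < d) (he : 0 < e) (hS : S.dim = 2)
    (hφ : φ ≫ φ = -(d • 𝟙 S)) (hψ : ψ ≫ ψ = e • 𝟙 S) (h : φ ≫ ψ = -(ψ ≫ φ)) (N : ℕ) :
    IsWeilType (S.powSucc N) (powSuccMap φ N) (N + 1) d ∧
      weilClassesOf (S.powSucc N) (powSuccMap φ N) (N + 1) d ≤ divisorClassesSpan (S.powSucc N).X (S.powSucc N).dim (N + 1) :=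
  have hW := isWeilType_powSucc_of_anticomm_of_sq_eq_nsmul hd he hS hφ hψ h N
  ⟨hW, weilClassesOf_powSucc_surface_le_divisorClassesSpan hS hW⟩

/-- **… hence the Weil classes of the QM-powers are ALGEBRAIC** — the Hodge conjecture for the Weil plane ON THE QM-CUBE LOCUS of every
`(3, d, δ)` component, in the kernel, unconditionally (trivially: they are Lefschetz there). [cite: vanGeemenVerra2003QuaternionicPryms, Lemma 4.5]
[cite: vanGeemen1994HodgeAV, §2.4, 4.10 and 5.4] [cite: MoonenZarhin1999LowDim, §2 (2.2)] -/
theorem weilClassesOf_qmPower_le_algebraicClasses {φ ψ : S ⟶ S} (hd : 0 < d) (he : 0 < e) (hS : S.dim = 2)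
    (hφ : φ ≫ φ = -(d • 𝟙 S)) (hψ : ψ ≫ ψ = e • 𝟙 S) (h : φ ≫ ψ = -(ψ ≫ φ)) (N : ℕ) :
    weilClassesOf (S.powSucc N) (powSuccMap φ N) (N + 1) d ≤ algebraicClasses (S.powSucc N).X (N + 1) :=
  weilClassesOf_powSucc_surface_le_algebraicClasses hS (isWeilType_powSucc_of_anticomm_of_sq_eq_nsmul hd he hS hφ hψ h N)

/-- **`K`-ISOGENY INVARIANCE: everything `K`-isogenous to a Weil-type power of an abelian surface has a Lefschetz Weil plane** — `g : X ⟶ S^{N+1}`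
an isogeny with `g ≫ Φ = χ ≫ g`, `χ² = −d`, `(S^{N+1}, Φ)` of Weil type `(m, d)` ⟹ `(X, χ)` is of Weil type `(m, d)` (the tree's
`IsWeilType.of_isIsogeny'`) and `weilClassesOf X χ m d ⊆ Dᵐ(X) ⊗ ℂ` (`B = D` is an isogeny invariant). This is the form the prequel's anchor
«`X ≅ A₀`, `A₀ ~ S³`» meets the Weil structure of a pencil member. [cite: vanGeemen1994HodgeAV, 4.14 and §3.6]
[cite: MoonenZarhin1999LowDim, (1.9) and §2 (2.2)] -/
theorem weilClassesOf_le_divisorClassesSpan_of_isIsogeny_powSucc_surface (hS : S.dim = 2) {Φ : S.powSucc N ⟶ S.powSucc N} {χ : X ⟶ X}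
    {m : ℕ} (g : X ⟶ S.powSucc N) (hg : AbelianVariety.IsIsogeny g) (hcomm : g ≫ Φ = χ ≫ g) (hχ : χ ≫ χ = -(d • 𝟙 X))
    (hW : IsWeilType (S.powSucc N) Φ m d) :
    IsWeilType X χ m d ∧ weilClassesOf X χ m d ≤ divisorClassesSpan X.X X.dim m :=
  have hX : IsWeilType X χ m d := hW.of_isIsogeny' g hg hcomm hχ
  ⟨hX, weilClassesOf_le_divisorClassesSpan_of_isWeilType_of_isDivisorGenerated hX
    (((isStablyNondegenerate_of_dim_pos_of_dim_le_three (X := S) (by omega) (by omega)).isDivisorGenerated_powSucc N).of_isIsogenous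
      ⟨g, hg⟩)⟩

/-- **… hence algebraic.** [cite: vanGeemen1994HodgeAV, §2.4, 4.10 and 4.14] [cite: MoonenZarhin1999LowDim, §2 (2.2)] -/
theorem weilClassesOf_le_algebraicClasses_of_isIsogeny_powSucc_surface (hS : S.dim = 2) {Φ : S.powSucc N ⟶ S.powSucc N} {χ : X ⟶ X}
    {m : ℕ} (g : X ⟶ S.powSucc N) (hg : AbelianVariety.IsIsogeny g) (hcomm : g ≫ Φ = χ ≫ g) (hχ : χ ≫ χ = -(d • 𝟙 X))
    (hW : IsWeilType (S.powSucc N) Φ m d) : weilClassesOf X χ m d ≤ algebraicClasses X.X m :=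
  (weilClassesOf_le_divisorClassesSpan_of_isIsogeny_powSucc_surface hS g hg hcomm hχ hW).2.trans
    (divisorClassesSpan_le_algebraicClasses_of_isSmoothProjective (AbelianVariety.isSmoothProjective_holds (A := X)) m)

end Summit.HodgeConjecture.HodgeConjecture.Ring2.SemiregularRepresentatives

end
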